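import Mathlib.NumberTheory.Height.NumberField
import Mathlib.RingTheory.DedekindDomain.SInteger
import Mathlib.Analysis.Normed.Group.Constructions
import HarnessLib

/-!
# The logarithmic embedding of `T`-units and its comparison with the height
# (Bombieri–Gubler, *Heights*, §5.2, the norm `‖u‖ = ĥ(x)` of the proof of Thm. 5.2.1)

In the proof of the unit-equation theorem (Bombieri–Gubler Thm. 5.2.1, ¶5.2.16, p. 136) the
finitely generated group `Γ` is identified modulo torsion with `ℤʳ ⊂ ℝʳ`, normed by
`‖u‖ = ĥ(x) = h(x₁) + h(x₂)`, "a norm" by an argument of Cassels (Minkowski + Northcott). For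
`Γ = R_T^× × R_T^×`, the `T`-units of a number field `F`, this linearisation is elementary and
we set it up here without Dirichlet's `S`-unit theorem: the **logarithmic embedding**

  `L_T : Fˣ → ℝ^{M_F^∞ ⊔ T}`, `x ↦ (m_v log |x|_v)_{v ∣ ∞} ⊕ (log |x|_w)_{w ∈ T}`

(`logEmbedding`; `m_v` the multiplicity of the infinite place, `|·|_w` the normalised absolute
value `NumberField.FinitePlace.mk w`) is a homomorphism into a finite-dimensional real vector
space with the sup norm, and for `T`-units it is comparable with Mathlib's (relative) Weil height:

* `norm_logEmbedding_le`: `‖L_T x‖ ≤ 2 h(x)` for every `x ∈ Fˣ` (each coordinate is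
  `± (log⁺|x|_v + log⁺|x⁻¹|_v) ≤ h(x) + h(x⁻¹) = 2h(x)`, Mathlib `Height.logHeight₁_inv`);
* `logHeight₁_le_of_mem_unit`: `h(x) ≤ (#M_F^∞ + #T) ‖L_T x‖` for `x ∈ R_T^×` (the places
  outside `M_F^∞ ∪ T` do not contribute to `h(x) = ∑_v m_v log⁺|x|_v + ∑_w log⁺|x|_w`,
  Mathlib `NumberField.logHeight₁_eq`).

So `½‖L_T x‖ ≤ h(x) ≤ c_T ‖L_T x‖` on `T`-units: a quasi-isometry, which is all the finiteness
argument needs (the exact identity `‖·‖ = ĥ` of B–G only sharpens constants).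

Namespace `Literature.NumberTheory.DiophantineGeometry`; one `def` (`logEmbedding`) and theorems.

## References

* E. Bombieri, W. Gubler, *Heights in Diophantine Geometry*, CUP 2006, ¶5.2.16 (p. 136) and
  Prop. 1.5.13 ff. (heights of `S`-units). [BombieriGubler2006]
-/

noncomputable section

open scoped Classical

open NumberField IsDedekindDomain Height Real

namespace Literature.NumberTheory.DiophantineGeometry

variable {F : Type*} [Field F] [NumberField F]

/-! ## Definition and homomorphism property -/

/-- **The logarithmic embedding** `x ↦ (m_v log |x|_v)_{v ∣ ∞} ⊕ (log |x|_w)_{w ∈ T}` of `Fˣ`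
into `ℝ^{M_F^∞ ⊔ T}` (sup norm), for a finite set `T` of finite places. (The classical
logarithmic embedding of Dirichlet's `S`-unit theorem; B–G ¶5.2.16 uses its image normed by the
height.) [cite: BombieriGubler2006, 5.2.16] -/
def logEmbedding (T : Finset (HeightOneSpectrum (𝓞 F))) (x : Fˣ) : InfinitePlace F ⊕ ↥T → ℝ :=
  Sum.elim (fun v : InfinitePlace F => (v.mult : ℝ) * Real.log (v (x : F)))
    (fun w : ↥T => Real.log (FinitePlace.mk (w : HeightOneSpectrum (𝓞 F)) (x : F)))

variable (T : Finset (HeightOneSpectrum (𝓞 F)))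

/-- Coordinates of the logarithmic embedding at infinite places. [folklore] -/
@[simp] theorem logEmbedding_inl (x : Fˣ) (v : InfinitePlace F) :
    logEmbedding T x (Sum.inl v) = (v.mult : ℝ) * Real.log (v (x : F)) := rfl

/-- Coordinates of the logarithmic embedding at the places of `T`. [folklore] -/
@[simp] theorem logEmbedding_inr (x : Fˣ) (w : ↥T) :
    logEmbedding T x (Sum.inr w) = Real.log (FinitePlace.mk (w : HeightOneSpectrum (𝓞 F)) (x : F)) :=
  rfl

/-- `L_T (xy) = L_T x + L_T y`. [folklore] -/
theorem logEmbedding_mul (x y : Fˣ) :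
    logEmbedding T (x * y) = logEmbedding T x + logEmbedding T y := by
  ext i
  rcases i with v | w
  · simp only [Pi.add_apply, logEmbedding_inl, Units.val_mul, map_mul]
    rw [Real.log_mul ((v.pos_iff).mpr x.ne_zero).ne' ((v.pos_iff).mpr y.ne_zero).ne']
    ring
  · simp only [Pi.add_apply, logEmbedding_inr, Units.val_mul, map_mul]
    rw [Real.log_mul (FinitePlace.pos_iff.mpr x.ne_zero).ne' (FinitePlace.pos_iff.mpr y.ne_zero).ne']

/-- `L_T 1 = 0`. [folklore] -/
theorem logEmbedding_one : logEmbedding T (1 : Fˣ) = 0 := by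
  ext i
  rcases i with v | w <;> simp

/-- `L_T` as a monoid homomorphism `Fˣ → ℝ^{M_F^∞ ⊔ T}` (additively written). [folklore] -/
def logEmbeddingHom : Fˣ →* Multiplicative (InfinitePlace F ⊕ ↥T → ℝ) where
  toFun x := Multiplicative.ofAdd (logEmbedding T x)
  map_one' := by rw [logEmbedding_one]; rfl
  map_mul' x y := by rw [logEmbedding_mul]; rfl

/-- `L_T (x⁻¹) = -L_T x`. [folklore] -/
theorem logEmbedding_inv (x : Fˣ) : logEmbedding T x⁻¹ = -logEmbedding T x := by
  have h := logEmbedding_mul T x⁻¹ x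
  rw [inv_mul_cancel, logEmbedding_one] at h
  exact eq_neg_of_add_eq_zero_left h.symm

/-- `L_T (xⁿ) = n • L_T x`. [folklore] -/
theorem logEmbedding_pow (x : Fˣ) (n : ℕ) : logEmbedding T (x ^ n) = n • logEmbedding T x := by
  induction n with
  | zero => rw [pow_zero, logEmbedding_one, zero_smul]
  | succ n ih => rw [pow_succ, logEmbedding_mul, ih, succ_nsmul]

/-- The twist `y x^{-k}` of the unit equation argument: `L_T (y (xᵏ)⁻¹) = L_T y - k • L_T x`.
[folklore] -/
theorem logEmbedding_mul_pow_inv (x y : Fˣ) (k : ℕ) :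
    logEmbedding T (y * (x ^ k)⁻¹) = logEmbedding T y - (k : ℝ) • logEmbedding T x := by
  rw [logEmbedding_mul, logEmbedding_inv, logEmbedding_pow, ← sub_eq_add_neg, Nat.cast_smul_eq_nsmul]

/-! ## Single places are bounded by the height -/

/-- The local term at an infinite place is bounded by the height:
`m_v log⁺|x|_v ≤ h(x)`. [folklore] -/
theorem mult_mul_posLog_le_logHeight₁ (x : F) (v : InfinitePlace F) :
    (v.mult : ℝ) * log⁺ (v x) ≤ logHeight₁ x := by
  rw [NumberField.logHeight₁_eq]
  have h1 : (v.mult : ℝ) * log⁺ (v x) ≤ ∑ v : InfinitePlace F, (v.mult : ℝ) * log⁺ (v x) :=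
    Finset.single_le_sum (f := fun w : InfinitePlace F => (w.mult : ℝ) * log⁺ (w x))
      (fun w _ => mul_nonneg (Nat.cast_nonneg _) posLog_nonneg) (Finset.mem_univ v)
  have h2 : (0 : ℝ) ≤ ∑ᶠ w : FinitePlace F, log⁺ (w x) := finsum_nonneg fun w => posLog_nonneg
  linarith

/-- The support of `w ↦ log⁺|x|_w` over the finite places is finite. [folklore] -/
theorem finite_support_posLog_finitePlace (x : F) :
    (Function.support fun w : FinitePlace F => log⁺ (w x)).Finite := by
  rcases eq_or_ne x 0 with rfl | hx
  · simp [Function.support]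
  refine (FinitePlace.hasFiniteMulSupport hx).subset fun w hw => ?_
  simp only [Function.mem_support, ne_eq] at hw
  simp only [Function.mem_mulSupport]
  intro h
  exact hw (by rw [h, posLog_one])

/-- The local term at a finite place is bounded by the height: `log⁺|x|_w ≤ h(x)`. [folklore] -/
theorem posLog_finitePlace_le_logHeight₁ (x : F) (w : FinitePlace F) :
    log⁺ (w x) ≤ logHeight₁ x := by
  rw [NumberField.logHeight₁_eq]
  have hs := finite_support_posLog_finitePlace x
  have h1 : log⁺ (w x) ≤ ∑ᶠ w : FinitePlace F, log⁺ (w x) := by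
    rw [finsum_eq_sum_of_support_subset_of_finite _ (Set.subset_insert w _) (hs.insert w)]
    exact Finset.single_le_sum (f := fun w : FinitePlace F => log⁺ (w x)) (fun w _ => posLog_nonneg)
      ((Set.Finite.mem_toFinset _).mpr (Set.mem_insert w _))
  have h2 : (0 : ℝ) ≤ ∑ v : InfinitePlace F, (v.mult : ℝ) * log⁺ (v x) :=
    Finset.sum_nonneg fun v _ => mul_nonneg (Nat.cast_nonneg _) posLog_nonneg
  linarith

omit [NumberField F] in
/-- `|log a| = log⁺ a + log⁺ a⁻¹`. [folklore] -/
theorem abs_log_eq_posLog_add_posLog_inv (a : ℝ) : |Real.log a| = log⁺ a + log⁺ a⁻¹ := by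
  have h := posLog_sub_posLog_inv (x := a)
  rcases le_or_gt 0 (Real.log a) with hl | hl
  · rw [abs_of_nonneg hl]
    have : log⁺ a⁻¹ = 0 := by
      rw [posLog_apply, Real.log_inv, max_eq_left (by linarith)]
    linarith
  · rw [abs_of_neg hl]
    have : log⁺ a = 0 := by rw [posLog_apply, max_eq_left hl.le]
    linarith

/-- **`‖L_T x‖ ≤ 2 h(x)`** for every `x ∈ Fˣ`: each coordinate of the logarithmic embedding is in
absolute value `m_v (log⁺|x|_v + log⁺|x⁻¹|_v) ≤ h(x) + h(x⁻¹) = 2 h(x)` (resp. without `m_v`).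
[cite: BombieriGubler2006, 5.2.16] -/
theorem norm_logEmbedding_le (x : Fˣ) : ‖logEmbedding T x‖ ≤ 2 * logHeight₁ (x : F) := by
  have hinv : logHeight₁ ((x : F)⁻¹) = logHeight₁ (x : F) := logHeight₁_inv _
  refine (pi_norm_le_iff_of_nonneg (by positivity)).mpr fun i => ?_
  rcases i with v | w
  · rw [logEmbedding_inl, Real.norm_eq_abs, abs_mul, Nat.abs_cast,
      abs_log_eq_posLog_add_posLog_inv, mul_add, ← map_inv₀]
    have h1 := mult_mul_posLog_le_logHeight₁ (x : F) v
    have h2 := mult_mul_posLog_le_logHeight₁ ((x : F)⁻¹) v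
    linarith
  · rw [logEmbedding_inr, Real.norm_eq_abs, abs_log_eq_posLog_add_posLog_inv, ← map_inv₀]
    have h1 := posLog_finitePlace_le_logHeight₁ (x : F) (FinitePlace.mk (w : HeightOneSpectrum (𝓞 F)))
    have h2 := posLog_finitePlace_le_logHeight₁ ((x : F)⁻¹)
      (FinitePlace.mk (w : HeightOneSpectrum (𝓞 F)))
    linarith

/-! ## `T`-units: the height is bounded by the embedding -/

/-- At a place `w ∉ T`, a `T`-unit has absolute value `1`. [folklore] -/
theorem finitePlace_mk_eq_one_of_mem_unit {x : Fˣ} (hx : x ∈ (T : Set (HeightOneSpectrum (𝓞 F))).unit F)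
    {w : HeightOneSpectrum (𝓞 F)} (hw : w ∉ T) : FinitePlace.mk w (x : F) = 1 := by
  have hval : w.valuation F (x : F) = 1 := hx w (by exact_mod_cast hw)
  rw [FinitePlace.mk_apply, FinitePlace.norm_embedding', hval, map_one, NNReal.coe_one]

/-- **`h(x) ≤ (#M_F^∞ + #T) ‖L_T x‖` for a `T`-unit `x`**: in
`h(x) = ∑_{v∣∞} m_v log⁺|x|_v + ∑_w log⁺|x|_w` only `w ∈ T` contribute, and each term is at
most the corresponding coordinate of `L_T x` in absolute value. [cite: BombieriGubler2006, 5.2.16] -/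
theorem logHeight₁_le_of_mem_unit {x : Fˣ} (hx : x ∈ (T : Set (HeightOneSpectrum (𝓞 F))).unit F) :
    logHeight₁ (x : F) ≤ (Fintype.card (InfinitePlace F) + T.card) * ‖logEmbedding T x‖ := by
  rw [NumberField.logHeight₁_eq]
  set N := ‖logEmbedding T x‖ with hN
  have hN0 : 0 ≤ N := norm_nonneg _
  -- infinite places
  have h1 : ∑ v : InfinitePlace F, (v.mult : ℝ) * log⁺ (v (x : F)) ≤
      ∑ _v : InfinitePlace F, N := by
    refine Finset.sum_le_sum fun v _ => ?_
    calc (v.mult : ℝ) * log⁺ (v (x : F)) ≤ |(v.mult : ℝ) * Real.log (v (x : F))| := by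
          rw [abs_mul, Nat.abs_cast, abs_log_eq_posLog_add_posLog_inv, mul_add]
          exact le_add_of_nonneg_right (mul_nonneg (Nat.cast_nonneg _) posLog_nonneg)
      _ = ‖logEmbedding T x (Sum.inl v)‖ := by rw [logEmbedding_inl, Real.norm_eq_abs]
      _ ≤ N := norm_le_pi_norm _ _
  -- finite places: only `w ∈ T` contribute
  have hsupp : (Function.support fun w : FinitePlace F => log⁺ (w (x : F))) ⊆
      ↑(T.attach.image fun w : ↥T => FinitePlace.mk (w : HeightOneSpectrum (𝓞 F))) := by
    intro w hw
    simp only [Function.mem_support, ne_eq] at hw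
    simp only [Finset.coe_image, Finset.coe_attach, Set.image_univ, Set.mem_range]
    by_contra h
    have hT : w.maximalIdeal ∉ T := fun hmem => h ⟨⟨_, hmem⟩, FinitePlace.mk_maximalIdeal w⟩
    apply hw
    rw [← FinitePlace.mk_maximalIdeal w, finitePlace_mk_eq_one_of_mem_unit T hx hT, posLog_one]
  have h2 : ∑ᶠ w : FinitePlace F, log⁺ (w (x : F)) ≤ ∑ _w ∈ T.attach, N := by
    rw [finsum_eq_finsetSum_of_support_subset _ hsupp]
    refine (Finset.sum_image_le_of_nonneg fun w _ => posLog_nonneg).trans ?_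
    refine Finset.sum_le_sum fun w _ => ?_
    calc log⁺ (FinitePlace.mk (w : HeightOneSpectrum (𝓞 F)) (x : F))
        ≤ |Real.log (FinitePlace.mk (w : HeightOneSpectrum (𝓞 F)) (x : F))| := by
          rw [abs_log_eq_posLog_add_posLog_inv]
          exact le_add_of_nonneg_right posLog_nonneg
      _ = ‖logEmbedding T x (Sum.inr w)‖ := by rw [logEmbedding_inr, Real.norm_eq_abs]
      _ ≤ N := norm_le_pi_norm _ _
  rw [Finset.sum_const, Finset.card_univ, nsmul_eq_mul] at h1
  rw [Finset.sum_const, Finset.card_attach, nsmul_eq_mul] at h2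
  linarith

end Literature.NumberTheory.DiophantineGeometry

end
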